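import Mathlib
import Summits.ResolutionOfSingularities.ResolutionOfSingularities.Theorems.PAlterationPicoverLocalModelTransversalExit
import Summits.ResolutionOfSingularities.ResolutionOfSingularities.Theorems.SoloInformedTorsorExits
import HarnessLib

/-!
# Crux `Steer` (stmt-ResolutionOfSingularities-16345), line `switching_dichotomy` — steered stalls are EMPTY at `p = 2`

Helper for the σ-line target `R2FourRankOneTwo` of chain W4.1 (CHAIN v5.4a §B2′, the
res-L0-w41-plan-2 liaison remark «`IsSingPrime` at the closed point of a regular member forces
`f − g² ∈ 𝔪²`, against the stall clause `∀ g, f − g^p ∉ 𝔪^p` — to be CHECKED against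
`RadicandRing`, not asserted»), checked here in the kernel. OURS (a statement about the route's
own objects; it replaces nothing of and is NOT a statement of the manuscript under review).

* `isRegularLocalRing_adjoinRoot_X_pow_sub_C_of_forall_not_mem_sq` — the local algebra: for a
  regular local ring `R` of prime characteristic `p` and `f ∈ R` of ORDER AT MOST ONE AFTER EVERY
  CLEANING (`∀ g, f − g^p ∉ 𝔪²`), the purely inseparable cover `R[T]/(T^p − f)` is a regular
  local ring. Proof: if the residue of `f` is not a `p`-th power, the closed fibre
  `κ[T]/(T^p − f̄)` is a field (Kummer) and the cover is regular
  (`isRegularLocalRing_adjoinRoot_X_pow_sub_C_of_forall_pow_ne`); otherwise `f ≡ c^p (mod 𝔪)` for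
  a lift `c`, and `f − c^p ∈ 𝔪 ∖ 𝔪²` is the transversal exit
  (`PicoverLocalModel.TransversalExit.isRegularLocalRing_adjoinRoot_of_transversal`).
* `isRegularLocalRing_adjoinRoot_localization_of_forall_not_mem_sq` — the same over the
  localisation `R_𝔪 ≅ R` (`IsLocalization.atUnits`), which is the ring the steered-run vocabulary
  reads the torsor germ over (`IsSingPrime R p f 𝔪 := ¬ IsRegularLocalRing (RadicandRing R_𝔪 p f)`,
  `RadicandRing S p f := AdjoinRoot (X ^ p − C f)`, res-L0-w41-plan-1's `Sketch-R2-steered.lean`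
  fb4f9514a6cb98fe §3.1–§3.2).
* `false_of_isSingPrime_of_forall_not_mem_sq` / `false_of_isSingPrime_two` — the run form with the
  bodies of `SteeredStallAt R p s N` UNFOLDED as binders: over a REGULAR member `R N ⊆ K`, the two
  stall clauses «singular at the closed point» and «`∀ g, (s N)^p − g^p ∉ 𝔪^p`» are contradictory
  when `p = 2` (then `𝔪^p = 𝔪²`). Regularity of the members of a steered run is taken as a
  hypothesis (it belongs to the run-existence piece E / B′).

For `p` odd the hypothesis `∀ g, f − g^p ∉ 𝔪^p` does NOT give regularity (`T³ = x²` over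
`k[x]_{(x)}`), which is why the σ-line target is cut by characteristic (CHAIN v5.4a).
-/

-- The namespace mirrors the chain's helper layout (`…Theorems.SwitchingDichotomy.<Piece>`) on purpose.
set_option linter.dupNamespace false

noncomputable section

namespace Summit.ResolutionOfSingularities.ResolutionOfSingularities.Theorems.SwitchingDichotomy.EmptyStallTwo

open Polynomial IsLocalRing

universe u

/-- **Order at most one after every cleaning ⇒ the `p`-cyclic cover is regular.** Let `R` be a
regular local ring of prime characteristic `p` and `f ∈ R` with `f − g^p ∉ 𝔪²` for every `g ∈ R`.
Then `R[T]/(T^p − f)` is a regular local ring. (Case split on whether the residue of `f` is a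
`p`-th power in the residue field: Kummer fibre, or transversal exit at a lift.) OURS. [folklore] -/
theorem isRegularLocalRing_adjoinRoot_X_pow_sub_C_of_forall_not_mem_sq
    {R : Type u} [CommRing R] [IsRegularLocalRing R] (p : ℕ) [Fact p.Prime] [CharP R p]
    (f : R) (hf : ∀ g : R, f - g ^ p ∉ maximalIdeal R ^ 2) :
    IsRegularLocalRing (AdjoinRoot ((X : R[X]) ^ p - C f)) := by
  classical
  by_cases hres : ∃ b : ResidueField R, b ^ p = residue R f
  · obtain ⟨b, hb⟩ := hres
    obtain ⟨c, rfl⟩ := residue_surjective b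
    have hmem : f - c ^ p ∈ maximalIdeal R := by
      rw [← residue_eq_zero_iff, map_sub, map_pow, ← hb, sub_self]
    exact PicoverLocalModel.TransversalExit.isRegularLocalRing_adjoinRoot_of_transversal p f c hmem
      (hf c)
  · push Not at hres
    exact isRegularLocalRing_adjoinRoot_X_pow_sub_C_of_forall_pow_ne (Fact.out) f hres

/-- A local ring is its own localisation at the maximal ideal: the elements of `𝔪.primeCompl`
are units. [folklore] -/
theorem primeCompl_maximalIdeal_le_isUnit (R : Type u) [CommRing R] [IsLocalRing R] :
    (maximalIdeal R).primeCompl ≤ IsUnit.submonoid R := fun x hx => by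
  have hx' : x ∉ maximalIdeal R := hx
  rwa [mem_maximalIdeal, mem_nonunits_iff, not_not] at hx'

/-- **The same over `R_𝔪`.** For a regular local ring `R` of prime characteristic `p` and `f ∈ R`
with `f − g^p ∉ 𝔪²` for all `g`, the cover `R_𝔪[T]/(T^p − f)` over the localisation of `R` at
its maximal ideal (canonically isomorphic to `R`, `IsLocalization.atUnits`) is a regular local
ring. OURS. [folklore] -/
theorem isRegularLocalRing_adjoinRoot_localization_of_forall_not_mem_sq
    {R : Type u} [CommRing R] [IsRegularLocalRing R] (p : ℕ) [Fact p.Prime] [CharP R p]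
    (f : R) (hf : ∀ g : R, f - g ^ p ∉ maximalIdeal R ^ 2) :
    IsRegularLocalRing (AdjoinRoot ((X : (Localization.AtPrime (maximalIdeal R))[X]) ^ p -
      C (algebraMap R (Localization.AtPrime (maximalIdeal R)) f))) := by
  set L := Localization.AtPrime (maximalIdeal R)
  let e₀ : R ≃ₐ[R] L :=
    IsLocalization.atUnits R (maximalIdeal R).primeCompl (primeCompl_maximalIdeal_le_isUnit R)
  let e : R ≃+* L := e₀.toRingEquiv
  have he : ∀ x : R, e x = algebraMap R L x := fun x => by
    change e₀ x = algebraMap R L x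
    simpa using e₀.commutes x
  have hehom : (e : R →+* L) = algebraMap R L := RingHom.ext he
  haveI : IsRegularLocalRing L := IsRegularLocalRing.of_ringEquiv e
  haveI : CharP L p := charP_of_injective_ringHom (f := (e : R →+* L)) e.injective p
  refine isRegularLocalRing_adjoinRoot_X_pow_sub_C_of_forall_not_mem_sq p (algebraMap R L f) ?_
  intro g' hg'
  obtain ⟨g, rfl⟩ := e.surjective g'
  -- `𝔪_L ^ 2` is the image of `𝔪_R ^ 2` under `e`
  have hmax : maximalIdeal L = (maximalIdeal R).map (e : R →+* L) := by
    rw [hehom]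
    exact (Localization.AtPrime.map_eq_maximalIdeal).symm
  have hmem : e (f - g ^ p) ∈ ((maximalIdeal R) ^ 2).map (e : R →+* L) := by
    rw [Ideal.map_pow, ← hmax, map_sub, map_pow, he f]
    exact hg'
  rw [Ideal.map_comap_of_equiv, Ideal.mem_comap] at hmem
  exact hf g (by simpa using hmem)

/-- **Run form (bodies of `SteeredStallAt` unfolded).** Over a REGULAR member `S ⊆ K` of a
steered run (`K` of prime characteristic `p`), the stall clauses «the torsor germ
`S_𝔪[T]/(T^p − f)` over the closed point is singular» and «`f − g^p ∉ 𝔪²` for every `g`» are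
contradictory. OURS. [folklore] -/
theorem false_of_isSingPrime_of_forall_not_mem_sq {K : Type u} [Field K] (p : ℕ) [Fact p.Prime]
    [CharP K p] (S : Subring K) (hreg : IsRegularLocalRing S) (f : S)
    (hsing : ¬ IsRegularLocalRing (AdjoinRoot ((X : (Localization.AtPrime (maximalIdeal S))[X]) ^ p -
      C (algebraMap S (Localization.AtPrime (maximalIdeal S)) f))))
    (hmult : ∀ g : S, f - g ^ p ∉ maximalIdeal S ^ 2) : False :=
  hsing (isRegularLocalRing_adjoinRoot_localization_of_forall_not_mem_sq p f hmult)

/-- **Steered stalls are empty at `p = 2`.** With `p = 2` the stall clause of `SteeredStallAt R p s N`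
reads `∀ g, (s N)^p − g^p ∉ 𝔪^p = 𝔪²`, so over a regular member `R N` it contradicts the
singularity clause `IsSingPrime (R N) p ((s N)^p) 𝔪`. Stated with `p` generic and `hp2 : p = 2`
so that it applies to the binders of the σ-line composition verbatim. OURS. [folklore] -/
theorem false_of_isSingPrime_two {K : Type u} [Field K] (p : ℕ) (hp2 : p = 2) [CharP K p]
    (R : ℕ → Subring K) (s : ℕ → K) (N : ℕ) [IsLocalRing (R N)]
    (hreg : IsRegularLocalRing (R N)) (hs : s N ^ p ∈ R N)
    (hsing : ¬ IsRegularLocalRing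
      (AdjoinRoot ((X : (Localization.AtPrime (maximalIdeal (R N)))[X]) ^ p -
        C (algebraMap (R N) (Localization.AtPrime (maximalIdeal (R N))) ⟨s N ^ p, hs⟩))))
    (hmult : ∀ g : R N, (⟨s N ^ p, hs⟩ : R N) - g ^ p ∉ maximalIdeal (R N) ^ p) : False := by
  subst hp2
  haveI : Fact (Nat.Prime 2) := ⟨Nat.prime_two⟩
  exact false_of_isSingPrime_of_forall_not_mem_sq 2 (R N) hreg ⟨s N ^ 2, hs⟩ hsing hmult

end Summit.ResolutionOfSingularities.ResolutionOfSingularities.Theorems.SwitchingDichotomy.EmptyStallTwo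

end
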